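import Literature.Barriers.SmoothPoincare4.ExoticContractibleProofs
import HarnessLib

/-!
# The absolute master statement `ContractibleRigidityFour` is the negation of Akbulut–Ruberman's Thm. B

Third sibling proof file of `Literature/Barriers/SmoothPoincare4/ExoticContractible.lean` (D-0021
barrier `ContractibleBarrierFour := ¬ ContractibleRigidityFour`, proved there from the named fact
`akbulutRuberman2016_theoremB`), companion to the last section of
`ExoticContractibleProofs.lean`, which does the same for the relative master statement (a)
(`relativeContractibleRigidityFour_iff_not_mazurCork`).

The master statement (b), `ContractibleRigidityFour` ("compact contractible smooth 4-manifolds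
with diffeomorphic boundaries which are homeomorphic are diffeomorphic"), is by `push_neg` exactly
the statement that no pair `(V, V′)` as in Akbulut–Ruberman's Thm. B exists
(`contractibleRigidityFour_iff_not_theoremB`), and the barrier is *equivalent* to Thm. B as
rendered (`contractibleBarrierFour_iff_theoremB`). Consequently `ContractibleRigidityFour` is not
a dischargeable fact: it is refuted by the very theorem its docstring cites — a proof of
`ContractibleRigidityFour` would be a disproof of "Theorem B. There are compact contractible
smooth 4-manifolds `V` and `V′` with diffeomorphic boundaries, such that they are homeomorphic
but not diffeomorphic to each other." as rendered in the tree. It stays a definition because it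
is the formal technique class of the barrier (D-0021: "the technique class as an explicit Lean
definition"); its `[cite]` tag points at the theorem that REFUTES it.

The file also records the printed relation between the two master statements. Thm. A of
loc. cit. turns a relatively exotic pair `(W, f)` into a pair `V`, `V′` with `∂V ≅ ∂V′` and
`V ≇ V′`, and Freedman's theorem makes `V`, `V′` homeomorphic (proof of Thm. B, §3). Read
contrapositively: absolute rigidity (b) implies relative rigidity (a) modulo those two named
facts (`relativeContractibleRigidityFour_of_contractibleRigidityFour`), so (b) says in
particular that there are no corks (`not_mazurCork_of_contractibleRigidityFour`); the converse
direction (a) ⇒ (b) is not printed and not claimed.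

## What is printed

* Akbulut–Ruberman 2016 (arXiv:1410.1461v3 = Comment. Math. Helv. 91 (2016) 1–19), Thm. B
  (§1): "There are compact contractible smooth 4-manifolds `V` and `V′` with diffeomorphic
  boundaries, such that they are homeomorphic but not diffeomorphic to each other."; proof of
  Thm. B (§3): "Apply Theorem A to `(W, τ)`, a cork ... This gives a pair of non-diffeomorphic
  manifolds `V` and `V′` with the same boundary (contractible ...). But Freedman's theorem says
  that `V` and `V′` are in fact homeomorphic, so they can be viewed as (absolutely) exotic
  pairs."; Thm. A (§1): "If `W` is a compact smooth 4-manifold and `F : W → W` a homeomorphism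
  whose restriction to `M = ∂W` is a diffeomorphism that does not extend to a self
  diffeomorphism of `W`. Then `W` contains a pair of smooth 4-manifolds `V` and `V′` homotopy
  equivalent to `W` with `∂V ≅ ∂V′`, such that `V` and `V′` are not diffeomorphic to each
  other."

No definition and no named fact is introduced here; all hypotheses are the tree's named facts
`akbulutRuberman2016_theoremB`, `akbulut1991_mazurCork` (`ExoticContractible.lean`),
`akbulutRuberman2016_theoremA_contractible` and
`freedmanQuinn1990_homeomorph_extends_contractible` (`ExoticContractibleProofs.lean`).

## References

[AkbulutRuberman2016] [Akbulut1991Fake] [FreedmanQuinn1990]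
-/

noncomputable section

open scoped Manifold ContDiff
open Function

namespace Literature.Barriers.SmoothPoincare4

universe u

/-! ### The absolute barrier is equivalent to Thm. B; the master statement (b) is its negation -/

/-- **The absolute barrier is equivalent to Akbulut–Ruberman's Thm. B as rendered**:
`ContractibleBarrierFour ↔ akbulutRuberman2016_theoremB`. Backward is
`contractibleBarrierFour_of_akbulutRuberman`; forward: if absolute rigidity fails, some compact
contractible smooth `V`, `V′` with boundary data `b`, `b′` have diffeomorphic boundaries, are
homeomorphic, and admit no diffeomorphism `V ≃ₘ V′` — a witness of Thm. B (classical
`push_neg`; `¬ Nonempty ↔ IsEmpty`). [cite: AkbulutRuberman2016, Thm. B] -/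
theorem contractibleBarrierFour_iff_theoremB :
    ContractibleBarrierFour.{u} ↔ akbulutRuberman2016_theoremB.{u} := by
  refine ⟨fun h => ?_, contractibleBarrierFour_of_akbulutRuberman⟩
  by_contra hB
  refine h fun V V' _ _ _ _ _ _ _ _ _ _ _ _ _ _ b b' hd hH => ?_
  by_contra hD
  exact hB ⟨V, V', ‹_›, ‹_›, ‹_›, ‹_›, ‹_›, ‹_›, ‹_›, ‹_›, ‹_›, ‹_›, ‹_›, ‹_›, ‹_›, ‹_›, b, b', hd,
    hH, not_nonempty_iff.mp hD⟩

-- `linter.deprecated` is off for the next declaration only: it must name the master statement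
-- (`RelativeContractibleRigidityFour` / `ContractibleRigidityFour`, kept verbatim in `ExoticContractible.lean`
-- but deprecated AS A NAMED FACT, verdict clean-up 2026-08-15) in order to characterise it.
set_option linter.deprecated false in
/-- **The master statement (b) is the negation of Thm. B**:
`ContractibleRigidityFour ↔ ¬ akbulutRuberman2016_theoremB`. In particular
`ContractibleRigidityFour` is refuted, not open, relative to Literature: discharging it would
disprove "There are compact contractible smooth 4-manifolds `V` and `V′` with diffeomorphic
boundaries, such that they are homeomorphic but not diffeomorphic to each other" as rendered in
the tree (`akbulutRuberman2016_theoremB`). [cite: AkbulutRuberman2016, Thm. B] -/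
theorem contractibleRigidityFour_iff_not_theoremB :
    ContractibleRigidityFour.{u} ↔ ¬ akbulutRuberman2016_theoremB.{u} := by
  rw [← contractibleBarrierFour_iff_theoremB, ContractibleBarrierFour, not_not]

/-! ### (b) implies (a): absolute rigidity is at least as strong as relative rigidity -/

-- `linter.deprecated` is off for the next declaration only: it must name the master statement
-- (`RelativeContractibleRigidityFour` / `ContractibleRigidityFour`, kept verbatim in `ExoticContractible.lean`
-- but deprecated AS A NAMED FACT, verdict clean-up 2026-08-15) in order to characterise it.
set_option linter.deprecated false in
/-- **Absolute rigidity implies relative rigidity, modulo Thm. A and Freedman–Quinn.** Assume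
Akbulut–Ruberman's Thm. A for contractible `W` (hypothesis `hA`: a boundary diffeomorphism of a
compact contractible smooth `W` extending to a self-homeomorphism but to no self-diffeomorphism
yields compact contractible smooth `V`, `V′` with `∂V ≅ ∂V′` and `V ≇ V′`) and Freedman–Quinn
11.1C (hypothesis `hF`: compact contractible 4-manifolds with homeomorphic boundaries are
homeomorphic). If absolute rigidity `ContractibleRigidityFour` held (hypothesis `h`), then every
boundary diffeomorphism `f` of a compact contractible smooth `W` that extends to a
self-homeomorphism would extend to a self-diffeomorphism: otherwise `(W, f)` is relatively
exotic, Thm. A produces `V ≇ V′` with `∂V ≅ ∂V′`, Freedman's theorem makes them homeomorphic,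
and `h` makes them diffeomorphic — the printed route "relatively exotic ⇒ absolutely exotic" of
the proof of Thm. B, read contrapositively.
[cite: AkbulutRuberman2016, Thm. A and proof of Thm. B (§3)] -/
theorem relativeContractibleRigidityFour_of_contractibleRigidityFour
    (hA : akbulutRuberman2016_theoremA_contractible.{u})
    (hF : freedmanQuinn1990_homeomorph_extends_contractible.{u})
    (h : ContractibleRigidityFour.{u}) : RelativeContractibleRigidityFour.{u} := by
  intro W _ _ _ _ _ _ _ b f hH
  by_contra hD
  obtain ⟨V, V', _, _, _, _, _, _, _, _, _, _, _, _, _, _, bV, bV', ⟨ψ⟩, hE⟩ := hA W b f hH hD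
  obtain ⟨e⟩ := h V V' bV bV' ⟨ψ⟩
    (nonempty_homeomorph_of_freedmanQuinn hF bV bV' ⟨ψ.toHomeomorph⟩)
  exact hE.false e

-- `linter.deprecated` is off for the next declaration only: it must name the master statement
-- (`RelativeContractibleRigidityFour` / `ContractibleRigidityFour`, kept verbatim in `ExoticContractible.lean`
-- but deprecated AS A NAMED FACT, verdict clean-up 2026-08-15) in order to characterise it.
set_option linter.deprecated false in
/-- **Absolute rigidity says there are no corks** (modulo Thm. A and Freedman–Quinn): with `hA`,
`hF` as above, `ContractibleRigidityFour → ¬ akbulut1991_mazurCork`, through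
`relativeContractibleRigidityFour_of_contractibleRigidityFour` and
`relativeContractibleRigidityFour_iff_not_mazurCork`. Contrapositively a single cork refutes the
master statement (b), which is `contractibleBarrierFour_of_theoremA` of the sibling file.
[cite: AkbulutRuberman2016, §1 and proof of Thm. B (§3)] [cite: Akbulut1991Fake, Thm. 2] -/
theorem not_mazurCork_of_contractibleRigidityFour
    (hA : akbulutRuberman2016_theoremA_contractible.{u})
    (hF : freedmanQuinn1990_homeomorph_extends_contractible.{u})
    (h : ContractibleRigidityFour.{u}) : ¬ akbulut1991_mazurCork.{u} :=
  relativeContractibleRigidityFour_iff_not_mazurCork.mp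
    (relativeContractibleRigidityFour_of_contractibleRigidityFour hA hF h)

end Literature.Barriers.SmoothPoincare4

end
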